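import Literature.Analysis.Calculus.AngularMomentumFields
import Mathlib.Analysis.Normed.Module.Dual
import HarnessLib

/-!
# Polarized contraction identities for the angular fields

Analysis support file (everything proved; no definitions, no named facts), continuing
`AngularMomentumFields` (A. Waldron, Invent. math. 217 (2019), §4, extrinsic route): the
POLARIZED form of the contraction of a bilinear map with the angular fields, needed for the
cross ("orbit–spin") terms of the total angular momentum `J_{ij} = L_{ij} + S_{ij}` acting on
tensor fields:

* `sum_sum_bilinear_angularField_polar` — for bilinear `B` (scalar-valued) and vectors `x, a`:
  `∑ᵢ∑ⱼ B(L_{ij}x, L_{ij}a) = 2(⟨x,a⟩ ∑ₖ B(bₖ,bₖ) − B(a,x))`;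
* `sum_sum_bilinear_angularField_polar_vec` — the same for vector-valued `B` (by duality).
With `a = x` these reduce to `sum_sum_bilinear_angularField(_vec)`.

References: A. Waldron, Invent. math. 217 (2019), §4.2 [Waldron2019]; [folklore].
-/

noncomputable section

open scoped RealInnerProductSpace

namespace Literature.Analysis.Calculus

variable {E : Type*} [NormedAddCommGroup E] [InnerProductSpace ℝ E]
variable {ι : Type*} [Fintype ι]

/-- **Polarized contraction of a bilinear form with the angular fields**:
`∑ᵢ∑ⱼ B(L_{ij}x, L_{ij}a) = 2(⟨x,a⟩ ∑ₖ B(bₖ,bₖ) − B(a,x))`. [folklore] -/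
theorem sum_sum_bilinear_angularField_polar (b : OrthonormalBasis ι ℝ E) (B : E →L[ℝ] E →L[ℝ] ℝ)
    (x a : E) :
    ∑ i, ∑ j, B (angularField b i j x) (angularField b i j a) =
      2 * (⟪x, a⟫ * ∑ k, B (b k) (b k) - B a x) := by
  -- expand `L_{ij}` and use bilinearity
  have hL : ∀ i j, B (angularField b i j x) (angularField b i j a) =
      ⟪x, b i⟫ * ⟪a, b i⟫ * B (b j) (b j) + ⟪x, b j⟫ * ⟪a, b j⟫ * B (b i) (b i) -
        ⟪x, b i⟫ * ⟪a, b j⟫ * B (b j) (b i) - ⟪x, b j⟫ * ⟪a, b i⟫ * B (b i) (b j) := by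
    intro i j
    simp only [angularField, map_sub, map_smul, FunLike.coe_sub, FunLike.coe_smul,
      Pi.sub_apply, Pi.smul_apply, smul_eq_mul]
    ring
  have hxa : ∑ i, ⟪x, b i⟫ * ⟪a, b i⟫ = ⟪x, a⟫ := by
    rw [← b.sum_inner_mul_inner x a]
    exact Finset.sum_congr rfl fun i _ => by rw [real_inner_comm (b i) a]
  -- `B(a, x)` in coordinates
  have hBax : B a x = ∑ i, ∑ j, ⟪x, b i⟫ * ⟪a, b j⟫ * B (b j) (b i) := by
    conv_lhs => rw [← b.sum_repr' a, ← b.sum_repr' x]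
    simp only [map_sum, map_smul, FunLike.coe_sum, FunLike.coe_smul,
      Finset.sum_apply, Pi.smul_apply, smul_eq_mul, Finset.mul_sum]
    refine Finset.sum_congr rfl fun i _ => Finset.sum_congr rfl fun j _ => ?_
    rw [real_inner_comm x (b i), real_inner_comm a (b j)]; ring
  have hBax' : ∑ i, ∑ j, ⟪x, b j⟫ * ⟪a, b i⟫ * B (b i) (b j) = B a x := by
    rw [hBax, Finset.sum_comm]
  simp_rw [hL, Finset.sum_sub_distrib, Finset.sum_add_distrib]
  rw [show ∑ i, ∑ j, ⟪x, b i⟫ * ⟪a, b i⟫ * B (b j) (b j) = ⟪x, a⟫ * ∑ k, B (b k) (b k) by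
      rw [← hxa, Finset.sum_mul]; exact Finset.sum_congr rfl fun i _ => by rw [Finset.mul_sum],
    show ∑ i, ∑ j, ⟪x, b j⟫ * ⟪a, b j⟫ * B (b i) (b i) = ⟪x, a⟫ * ∑ k, B (b k) (b k) by
      rw [Finset.sum_comm, ← hxa, Finset.sum_mul]
      exact Finset.sum_congr rfl fun i _ => by rw [Finset.mul_sum],
    hBax', ← hBax]
  ring

/-- The vector-valued version: for `B : E →L E →L F`,
`∑ᵢ∑ⱼ B(L_{ij}x, L_{ij}a) = 2(⟨x,a⟩ ∑ₖ B(bₖ,bₖ) − B(a,x))`. [folklore] -/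
theorem sum_sum_bilinear_angularField_polar_vec {F : Type*} [NormedAddCommGroup F]
    [NormedSpace ℝ F] (b : OrthonormalBasis ι ℝ E) (B : E →L[ℝ] E →L[ℝ] F) (x a : E) :
    ∑ i, ∑ j, B (angularField b i j x) (angularField b i j a) =
      (2 : ℝ) • (⟪x, a⟫ • ∑ k, B (b k) (b k) - B a x) := by
  refine (SeparatingDual.eq_iff_forall_dual_eq (R := ℝ)).2 fun ℓ => ?_
  have h := sum_sum_bilinear_angularField_polar b ((ContinuousLinearMap.compL ℝ E F ℝ ℓ).comp B) x a
  simp only [ContinuousLinearMap.comp_apply, ContinuousLinearMap.compL_apply] at h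
  simp only [map_sum, map_smul, map_sub, smul_eq_mul]
  rw [h]

end Literature.Analysis.Calculus
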